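import Summits.CriticalPhenomena.Ising3DConformalLimit.Theorems.FKParityRobustnessDepletionBoundHTE
import Literature.Probability.LatticeModels.GKSInequalities
import Literature.Probability.LatticeModels.PlusFreeComparison
import Literature.Probability.LatticeModels.ModifiedSimonInequality
import HarnessLib
/-!
# `StrandShadow` (stmt-CriticalPhenomena-14626), line `Sketch`: composition cores (lead's helper file)

Sorry-free, dimension-free part of the line skeleton `Cruxes/StrandShadow/Lines/Sketch.lean`:
junk lemmas + the junk decomposition `LHS = LHS_clean + J` of the crux's left side (adapted from
the standing disprover's `Cruxes/StrandShadow/Disproof.lean` §1), the HT dictionary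
`⟨σ_A⟩^free·Z^∅_t = Z^A_t`, `shadow_arith` (the real arithmetic), `int_of_replica_gain`
(replica identities + gain ⇒ clause-(iii) inequality, the card's `GainGivesINT`), `clean_core`
((★) + three-clean + symmetry + INT ⇒ `LHS_clean ≤ (1 − (2/3)c₀)Z₀₁G₂₃`, i.e. the repaired crux
`C′` at one scale) and `shadow_core` (+ junk margin ⇒ the formal bound, constant `(1−κ)(2/3)c`).
The registered stubs of the line are exactly the hypotheses consumed; the skeleton's lattice
composition is `shadow_core` at `G_N`, `β_c(3)` (instances bridged with `convert`).
Refs: [AizenmanCMP1982]; Lebowitz, CMP 35 (1974); [HansenJiangKlausen2025] §2. -/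

noncomputable section
open Finset SimpleGraph Literature.Probability.LatticeModels
open Summit.CriticalPhenomena.Ising3DConformalLimit.Theorems
namespace Summit.CriticalPhenomena.Ising3DConformalLimit.Theorems.StrandShadowSketch

open scoped Classical

/-! ## Junk lemmas, junk decomposition, HT dictionary, and the composition cores -/

section Junk -- adapted from Cruxes/StrandShadow/Disproof.lean §1 (refuter-cdisprove-stmt-CriticalPhenomena-14626-0)
variable {V : Type*} (G : SimpleGraph V) [DecidableEq V] [G.LocallyFinite]

/-- For a pair, outside `Λ` the free b.c. glues `+1`: `σ_xσ_y = σ_{{x,y} ∩ Λ}` on glued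
configurations (pair case of the junk mechanism of Disproof §1). -/
theorem spinProduct_pair_glue_free (Λ : Finset V) (x y : V) (τ : Λ → ℤˣ) :
    spinProduct {x, y} (glue Λ τ .free) = spinProduct (({x, y} : Finset V) ∩ Λ) (glue Λ τ .free) := by
  unfold spinProduct
  rw [← Finset.prod_filter_mul_prod_filter_not {x, y} (· ∈ Λ)]
  have h1 : ({x, y} : Finset V).filter (· ∈ Λ) = {x, y} ∩ Λ := by
    ext z; simp [Finset.mem_inter]
  have h2 : ∏ z ∈ ({x, y} : Finset V).filter (fun z => ¬ z ∈ Λ), spinAt z (glue Λ τ .free) = 1 := by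
    refine Finset.prod_eq_one fun z hz => ?_
    have hz' : z ∉ Λ := (Finset.mem_filter.1 hz).2
    simp [spinAt, glue_apply_of_notMem _ _ _ hz']
  rw [h1, h2, mul_one]

/-- `⟨σ_xσ_y⟩^free_Λ = ⟨σ_{{x,y} ∩ Λ}⟩^free_Λ` (pair case of the junk mechanism). -/
theorem isingCorr_free_pair_eq_inter (Λ : Finset V) (β h : ℝ) (x y : V) :
    isingCorr G Λ β h .free {x, y} = isingCorr G Λ β h .free (({x, y} : Finset V) ∩ Λ) := by
  rw [isingCorr, isingCorr, isingExpect, isingExpect,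
    integral_isingMeasure G Λ β h .free (measurable_spinProduct _),
    integral_isingMeasure G Λ β h .free (measurable_spinProduct _)]
  congr 1
  refine Finset.sum_congr rfl fun τ _ => ?_
  rw [spinProduct_pair_glue_free Λ x y τ]

/-- Both sites out of the volume: the pair "correlation" is the junk value `⟨σ_∅⟩ = 1`. -/
theorem isingCorr_free_pair_eq_one' (Λ : Finset V) (β h : ℝ) {x y : V} (hx : x ∉ Λ) (hy : y ∉ Λ) :
    isingCorr G Λ β h .free {x, y} = 1 := by
  have : ({x, y} : Finset V) ∩ Λ = ∅ := by
    ext z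
    simp only [Finset.mem_inter, Finset.mem_insert, Finset.mem_singleton, Finset.notMem_empty,
      iff_false, not_and]
    rintro (rfl | rfl) <;> assumption
  rw [isingCorr_free_pair_eq_inter, this, isingCorr, isingExpect,
    integral_isingMeasure G Λ β h .free (measurable_spinProduct ∅)]
  simp only [spinProduct, Finset.prod_empty, mul_one]
  exact div_self (isingPartitionFunction_pos G Λ β h .free).ne'

/-- One site in, one out, zero field: the pair "correlation" is `⟨σ_y⟩^free_{Λ;β,0} = 0`. -/
theorem isingCorr_free_pair_eq_zero' (Λ : Finset V) (β : ℝ) {x y : V} (hx : x ∉ Λ) (hy : y ∈ Λ) :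
    isingCorr G Λ β 0 .free {x, y} = 0 := by
  rw [isingCorr_free_pair_eq_inter]
  have hxy : ({x, y} : Finset V) ∩ Λ = {y} := by
    ext z
    simp only [Finset.mem_inter, Finset.mem_insert, Finset.mem_singleton]
    constructor
    · rintro ⟨hz | hz, hzΛ⟩
      · exact absurd hzΛ (hz ▸ hx)
      · exact hz
    · intro hz
      exact ⟨Or.inr hz, hz ▸ hy⟩
  rw [hxy]
  exact isingCorr_free_of_odd_card_holds G Λ β (Finset.singleton_subset_iff.2 hy) (by simp)
end Junk
section Decomp
variable {V : Type*} [Fintype V] [DecidableEq V] (G : SimpleGraph V) [DecidableRel G.Adj]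

/-- **Junk decomposition** `LHS = LHS_clean + J` (Disproof §1 `lhs_decomposition`): both of
`a₂,a₃` swallowed by the `a₀`-cluster ⇒ summand `t^{|F|}·1`; exactly one ⇒ `0`. -/
theorem lhs_decomposition' (𝒯 : Finset (Finset (Sym2 V))) (t β : ℝ) (a₀ a₂ a₃ : V) :
    (∑ F ∈ 𝒯, t ^ F.card * isingCorr G (Finset.univ.filter fun v : V =>
        ¬ (SimpleGraph.fromEdgeSet (↑F : Set (Sym2 V))).Reachable a₀ v) β 0 .free {a₂, a₃}) =
      (∑ F ∈ 𝒯.filter (fun F : Finset (Sym2 V) =>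
          ¬ (SimpleGraph.fromEdgeSet (↑F : Set (Sym2 V))).Reachable a₀ a₂ ∧
          ¬ (SimpleGraph.fromEdgeSet (↑F : Set (Sym2 V))).Reachable a₀ a₃),
        t ^ F.card * isingCorr G (Finset.univ.filter fun v : V =>
          ¬ (SimpleGraph.fromEdgeSet (↑F : Set (Sym2 V))).Reachable a₀ v) β 0 .free {a₂, a₃}) +
      ∑ F ∈ 𝒯.filter (fun F : Finset (Sym2 V) =>
          (SimpleGraph.fromEdgeSet (↑F : Set (Sym2 V))).Reachable a₀ a₂ ∧
          (SimpleGraph.fromEdgeSet (↑F : Set (Sym2 V))).Reachable a₀ a₃), t ^ F.card := by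
  set R : Finset (Sym2 V) → V → Prop := fun F v =>
    (SimpleGraph.fromEdgeSet (↑F : Set (Sym2 V))).Reachable a₀ v with hR
  set f : Finset (Sym2 V) → ℝ := fun F => t ^ F.card *
    isingCorr G (Finset.univ.filter fun v : V => ¬ R F v) β 0 .free {a₂, a₃} with hf
  have hvol : ∀ (F : Finset (Sym2 V)) (v : V), v ∈ (univ.filter fun w : V => ¬ R F w) ↔ ¬ R F v :=
    fun F v => by simp
  rw [← Finset.sum_filter_add_sum_filter_not 𝒯 (fun F => ¬ R F a₂ ∧ ¬ R F a₃) f]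
  congr 1
  rw [← Finset.sum_filter_add_sum_filter_not (𝒯.filter fun F => ¬(¬ R F a₂ ∧ ¬ R F a₃))
    (fun F => R F a₂ ∧ R F a₃) f]
  have hboth : (𝒯.filter fun F => ¬(¬ R F a₂ ∧ ¬ R F a₃)).filter (fun F => R F a₂ ∧ R F a₃) =
      𝒯.filter (fun F => R F a₂ ∧ R F a₃) := by
    ext F; simp only [Finset.mem_filter]; tauto
  have hzero : ∑ F ∈ (𝒯.filter fun F => ¬(¬ R F a₂ ∧ ¬ R F a₃)).filter (fun F => ¬ (R F a₂ ∧ R F a₃)),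
      f F = 0 := by
    refine Finset.sum_eq_zero fun F hF => ?_
    simp only [Finset.mem_filter] at hF
    obtain ⟨⟨_, hF1⟩, hF2⟩ := hF
    by_cases h2 : R F a₂
    · have h3 : ¬ R F a₃ := fun h3 => hF2 ⟨h2, h3⟩
      simp only [hf]
      rw [isingCorr_free_pair_eq_zero' G _ β (by simp [h2]) (by simp [h3]), mul_zero]
    · have h3 : R F a₃ := by
        by_contra h3; exact hF1 ⟨h2, h3⟩
      simp only [hf]
      rw [Finset.pair_comm, isingCorr_free_pair_eq_zero' G _ β (by simp [h3]) (by simp [h2]),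
        mul_zero]
  rw [hzero, add_zero, hboth]
  refine Finset.sum_congr rfl fun F hF => ?_
  simp only [Finset.mem_filter] at hF
  simp only [hf]
  have h2 : a₂ ∉ (Finset.univ.filter fun v : V => ¬ R F v) := by
    rw [hvol, not_not]; exact hF.2.1
  have h3 : a₃ ∉ (Finset.univ.filter fun v : V => ¬ R F v) := by
    rw [hvol, not_not]; exact hF.2.2
  rw [isingCorr_free_pair_eq_one' G _ β 0 h2 h3, mul_one]

/-- HT dictionary on the whole graph: `⟨σ_A⟩^free_G · Z^∅_t(G) = Z^A_t(G)`, `t = tanh β`. -/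
theorem isingCorr_univ_mul_loopO1_empty (β : ℝ) (A : Finset V) :
    isingCorr G Finset.univ β 0 .free A * loopO1PartitionFunction G (Real.tanh β) ∅ =
      loopO1PartitionFunction G (Real.tanh β) A := by
  rw [isingCorr_free_eq_hteSum_div G Finset.univ β (Finset.subset_univ A),
    DepletionBound.loopO1PartitionFunction_eq_hteSum, DepletionBound.loopO1PartitionFunction_eq_hteSum]
  have hpos : 0 < hteSum G Finset.univ (Real.tanh β) ∅ := hteSum_empty_pos G _ β
  field_simp

/-- **The real arithmetic of the composition**: junk split, pair split, three-clean, symmetry,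
replica identities, gain, junk margin and the HT dictionary give `L ≤ (1 − (1−κ)(2/3)c)Z₀₁G₂₃`. -/
theorem shadow_arith {L Lc J C23 C13 C12 ZA Z01 Z0 G01 G23 G02 G13 G03 G12 σA EX EY EXY c κ : ℝ}
    (hL : L = Lc + J) (hps : Lc = C23) (htc : C23 + C13 + C12 ≤ ZA)
    (hs02 : G02 = G01) (hs03 : G03 = G01) (hs13 : G13 = G23) (hs12 : G12 = G23)
    (hC13 : C13 = C23) (hC12 : C12 = C23)
    (hcov : σA - (G01 * G23 + G02 * G13 + G03 * G12) = 8 * (EXY - EX * EY))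
    (hblue : G01 = 2 * EX) (hred : G23 = 2 * EY)
    (hgain : EXY ≤ (1 - c) * EX * EY) (hjunk : J ≤ κ * (Z01 * G23 - Lc))
    (hd01 : G01 * Z0 = Z01) (hdA : σA * Z0 = ZA) (hZ0 : 0 < Z0) (hκ : κ < 1) :
    L ≤ (1 - (1 - κ) * (2 / 3 * c)) * Z01 * G23 := by
  have hINT : σA ≤ (3 - 2 * c) * (G01 * G23) := by
    rw [hs02, hs03, hs13, hs12] at hcov
    have h1 : EXY - EX * EY ≤ -(c * (EX * EY)) := by nlinarith [hgain]
    have h2 : c * (G01 * G23) = 4 * (c * (EX * EY)) := by rw [hblue, hred]; ring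
    have h2' : G01 * G23 = 4 * (EX * EY) := by rw [hblue, hred]; ring
    linarith [h1, hcov, h2, h2']
  have h3 : 3 * C23 ≤ σA * Z0 := by rw [hdA]; linarith
  have h4 : σA * Z0 ≤ (3 - 2 * c) * (Z01 * G23) :=
    calc σA * Z0 ≤ (3 - 2 * c) * (G01 * G23) * Z0 := mul_le_mul_of_nonneg_right hINT hZ0.le
      _ = (3 - 2 * c) * (Z01 * G23) := by rw [← hd01]; ring
  have hclean : Lc ≤ (1 - 2 / 3 * c) * Z01 * G23 := by rw [hps]; linarith [h3, h4]
  have hκ' : 0 ≤ 1 - κ := by linarith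
  have h5 : (1 - κ) * Lc ≤ (1 - κ) * ((1 - 2 / 3 * c) * Z01 * G23) :=
    mul_le_mul_of_nonneg_left hclean hκ'
  rw [hL]
  linarith [hjunk, h5]

/-- **Finite-graph core of the composition**: `hps`, `htc`, `hsym`, `hrep`, a gain `c` and a
junk margin `κ < 1` give the formal shadow inequality with constant `(1 − κ)(2/3)c`. -/
theorem shadow_core {β c κ : ℝ} (hβ : 0 ≤ β) (hκ : κ < 1) (a : Fin 4 → V)
    (hps : (∑ F ∈ (tJoins G Set.univ {a 0, a 1}).filter (fun F : Finset (Sym2 V) =>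
            ¬ (SimpleGraph.fromEdgeSet (↑F : Set (Sym2 V))).Reachable (a 0) (a 2) ∧
            ¬ (SimpleGraph.fromEdgeSet (↑F : Set (Sym2 V))).Reachable (a 0) (a 3)),
          Real.tanh β ^ F.card * isingCorr G (Finset.univ.filter fun v : V =>
            ¬ (SimpleGraph.fromEdgeSet (↑F : Set (Sym2 V))).Reachable (a 0) v) β 0 .free {a 2, a 3})
        = ∑ F ∈ (tJoins G Set.univ (Finset.univ.image a)).filter (fun F : Finset (Sym2 V) =>
            ¬ (SimpleGraph.fromEdgeSet (↑F : Set (Sym2 V))).Reachable (a 0) (a 2) ∧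
            ¬ (SimpleGraph.fromEdgeSet (↑F : Set (Sym2 V))).Reachable (a 0) (a 3)),
          Real.tanh β ^ F.card)
    (htc : (∑ F ∈ (tJoins G Set.univ (Finset.univ.image a)).filter (fun F : Finset (Sym2 V) =>
            ¬ (SimpleGraph.fromEdgeSet (↑F : Set (Sym2 V))).Reachable (a 0) (a 2) ∧
            ¬ (SimpleGraph.fromEdgeSet (↑F : Set (Sym2 V))).Reachable (a 0) (a 3)),
            Real.tanh β ^ F.card) +
      (∑ F ∈ (tJoins G Set.univ (Finset.univ.image a)).filter (fun F : Finset (Sym2 V) =>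
            ¬ (SimpleGraph.fromEdgeSet (↑F : Set (Sym2 V))).Reachable (a 0) (a 1) ∧
            ¬ (SimpleGraph.fromEdgeSet (↑F : Set (Sym2 V))).Reachable (a 0) (a 3)),
            Real.tanh β ^ F.card) +
      (∑ F ∈ (tJoins G Set.univ (Finset.univ.image a)).filter (fun F : Finset (Sym2 V) =>
            ¬ (SimpleGraph.fromEdgeSet (↑F : Set (Sym2 V))).Reachable (a 0) (a 1) ∧
            ¬ (SimpleGraph.fromEdgeSet (↑F : Set (Sym2 V))).Reachable (a 0) (a 2)),
            Real.tanh β ^ F.card)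
        ≤ ∑ F ∈ tJoins G Set.univ (Finset.univ.image a), Real.tanh β ^ F.card)
    (hsym : (let Gc : Fin 4 → Fin 4 → ℝ := fun i j => isingCorr G Finset.univ β 0 .free {a i, a j}
       let C : Fin 4 → Fin 4 → ℝ := fun j k =>
         ∑ F ∈ (tJoins G Set.univ (Finset.univ.image a)).filter (fun F : Finset (Sym2 V) =>
            ¬ (SimpleGraph.fromEdgeSet (↑F : Set (Sym2 V))).Reachable (a 0) (a j) ∧
            ¬ (SimpleGraph.fromEdgeSet (↑F : Set (Sym2 V))).Reachable (a 0) (a k)),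
           Real.tanh β ^ F.card
       Gc 0 2 = Gc 0 1 ∧ Gc 0 3 = Gc 0 1 ∧ Gc 1 3 = Gc 2 3 ∧ Gc 1 2 = Gc 2 3 ∧
         C 1 3 = C 2 3 ∧ C 1 2 = C 2 3))
    (hrep : (let Zs : Finset V → ℝ := fun A =>
         isingPartitionFunction G A (2 * β) 0 .free * isingPartitionFunction G Aᶜ (2 * β) 0 .free
       let X : Finset V → ℝ := fun A =>
         if a 0 ∈ A ∧ a 1 ∈ A then isingCorr G A (2 * β) 0 .free {a 0, a 1} else 0
       let Y : Finset V → ℝ := fun A =>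
         if a 2 ∉ A ∧ a 3 ∉ A then isingCorr G Aᶜ (2 * β) 0 .free {a 2, a 3} else 0
       let E : (Finset V → ℝ) → ℝ := fun f => (∑ A : Finset V, Zs A * f A) / ∑ A : Finset V, Zs A
       let Gc : Fin 4 → Fin 4 → ℝ := fun i j => isingCorr G Finset.univ β 0 .free {a i, a j}
       isingCorr G Finset.univ β 0 .free (Finset.univ.image a)
           - (Gc 0 1 * Gc 2 3 + Gc 0 2 * Gc 1 3 + Gc 0 3 * Gc 1 2)
         = 8 * (E (fun A => X A * Y A) - E X * E Y) ∧
       Gc 0 1 = 2 * E X ∧ Gc 2 3 = 2 * E Y))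
    (hgain : (let Zs : Finset V → ℝ := fun A =>
         isingPartitionFunction G A (2 * β) 0 .free * isingPartitionFunction G Aᶜ (2 * β) 0 .free
       let X : Finset V → ℝ := fun A =>
         if a 0 ∈ A ∧ a 1 ∈ A then isingCorr G A (2 * β) 0 .free {a 0, a 1} else 0
       let Y : Finset V → ℝ := fun A =>
         if a 2 ∉ A ∧ a 3 ∉ A then isingCorr G Aᶜ (2 * β) 0 .free {a 2, a 3} else 0
       let E : (Finset V → ℝ) → ℝ := fun f => (∑ A : Finset V, Zs A * f A) / ∑ A : Finset V, Zs A
       E (fun A => X A * Y A) ≤ (1 - c) * E X * E Y))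
    (hjunk : (∑ F ∈ (tJoins G Set.univ {a 0, a 1}).filter (fun F : Finset (Sym2 V) =>
            (SimpleGraph.fromEdgeSet (↑F : Set (Sym2 V))).Reachable (a 0) (a 2) ∧
            (SimpleGraph.fromEdgeSet (↑F : Set (Sym2 V))).Reachable (a 0) (a 3)),
          Real.tanh β ^ F.card)
         ≤ κ * (loopO1PartitionFunction G (Real.tanh β) {a 0, a 1} *
               isingCorr G Finset.univ β 0 .free {a 2, a 3}
             - ∑ F ∈ (tJoins G Set.univ {a 0, a 1}).filter (fun F : Finset (Sym2 V) =>
                 ¬ (SimpleGraph.fromEdgeSet (↑F : Set (Sym2 V))).Reachable (a 0) (a 2) ∧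
                 ¬ (SimpleGraph.fromEdgeSet (↑F : Set (Sym2 V))).Reachable (a 0) (a 3)),
               Real.tanh β ^ F.card * isingCorr G (Finset.univ.filter fun v : V =>
                 ¬ (SimpleGraph.fromEdgeSet (↑F : Set (Sym2 V))).Reachable (a 0) v)
                 β 0 .free {a 2, a 3})) :
    (∑ F ∈ tJoins G Set.univ {a 0, a 1}, Real.tanh β ^ F.card *
        isingCorr G (Finset.univ.filter fun v : V =>
          ¬ (SimpleGraph.fromEdgeSet (↑F : Set (Sym2 V))).Reachable (a 0) v) β 0 .free {a 2, a 3})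
      ≤ (1 - (1 - κ) * (2 / 3 * c)) * loopO1PartitionFunction G (Real.tanh β) {a 0, a 1} *
          isingCorr G Finset.univ β 0 .free {a 2, a 3} := by
  simp only at hsym hrep hgain
  obtain ⟨hcov, hblue, hred⟩ := hrep
  obtain ⟨hs02, hs03, hs13, hs12, hsC13, hsC12⟩ := hsym
  have ht : 0 ≤ Real.tanh β := by
    rw [Real.tanh_eq_sinh_div_cosh]
    exact div_nonneg (Real.sinh_nonneg_iff.2 hβ) (Real.cosh_pos _).le
  have hZ0pos : 0 < loopO1PartitionFunction G (Real.tanh β) ∅ :=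
    loopO1PartitionFunction_empty_pos G ht
  have hdict01 := isingCorr_univ_mul_loopO1_empty G β {a 0, a 1}
  have hdictA : isingCorr G Finset.univ β 0 .free (Finset.univ.image a) *
      loopO1PartitionFunction G (Real.tanh β) ∅ =
        ∑ F ∈ tJoins G Set.univ (Finset.univ.image a), Real.tanh β ^ F.card := by
    rw [isingCorr_univ_mul_loopO1_empty G β, DepletionBound.loopO1PartitionFunction_eq_hteSum,
      DepletionBound.sum_tJoins_pow_eq_hteSum]
  have hL := lhs_decomposition' G (tJoins G Set.univ {a 0, a 1}) (Real.tanh β) β (a 0) (a 2) (a 3)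
  exact shadow_arith hL hps htc hs02 hs03 hs13 hs12 hsC13 hsC12 hcov hblue hred hgain hjunk hdict01
    hdictA hZ0pos hκ

/-- The algebra of `int_of_replica_gain`. -/
theorem int_arith {σA G01 G23 G02 G13 G03 G12 EX EY EXY c : ℝ}
    (hcov : σA - (G01 * G23 + G02 * G13 + G03 * G12) = 8 * (EXY - EX * EY))
    (hblue : G01 = 2 * EX) (hred : G23 = 2 * EY) (hgain : EXY ≤ (1 - c) * EX * EY) :
    2 * c * (G01 * G23) ≤ G01 * G23 + G02 * G13 + G03 * G12 - σA := by
  have h1 : EXY - EX * EY ≤ -(c * (EX * EY)) := by nlinarith [hgain]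
  have h2 : c * (G01 * G23) = 4 * (c * (EX * EY)) := by rw [hblue, hred]; ring
  linarith [hcov, h1, h2]

/-- **INT from the sponge side** (`GainGivesINT`): replica identities + gain `c` give
`2c·G₀₁G₂₃ ≤ G₀₁G₂₃ + G₀₂G₁₃ + G₀₃G₁₂ − ⟨σ_A⟩` (the form of `Disproof.INT`). -/
theorem int_of_replica_gain {β c : ℝ} (a : Fin 4 → V)
    (hrep : (let Zs : Finset V → ℝ := fun A =>
         isingPartitionFunction G A (2 * β) 0 .free * isingPartitionFunction G Aᶜ (2 * β) 0 .free
       let X : Finset V → ℝ := fun A =>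
         if a 0 ∈ A ∧ a 1 ∈ A then isingCorr G A (2 * β) 0 .free {a 0, a 1} else 0
       let Y : Finset V → ℝ := fun A =>
         if a 2 ∉ A ∧ a 3 ∉ A then isingCorr G Aᶜ (2 * β) 0 .free {a 2, a 3} else 0
       let E : (Finset V → ℝ) → ℝ := fun f => (∑ A : Finset V, Zs A * f A) / ∑ A : Finset V, Zs A
       let Gc : Fin 4 → Fin 4 → ℝ := fun i j => isingCorr G Finset.univ β 0 .free {a i, a j}
       isingCorr G Finset.univ β 0 .free (Finset.univ.image a)
           - (Gc 0 1 * Gc 2 3 + Gc 0 2 * Gc 1 3 + Gc 0 3 * Gc 1 2)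
         = 8 * (E (fun A => X A * Y A) - E X * E Y) ∧
       Gc 0 1 = 2 * E X ∧ Gc 2 3 = 2 * E Y))
    (hgain : (let Zs : Finset V → ℝ := fun A =>
         isingPartitionFunction G A (2 * β) 0 .free * isingPartitionFunction G Aᶜ (2 * β) 0 .free
       let X : Finset V → ℝ := fun A =>
         if a 0 ∈ A ∧ a 1 ∈ A then isingCorr G A (2 * β) 0 .free {a 0, a 1} else 0
       let Y : Finset V → ℝ := fun A =>
         if a 2 ∉ A ∧ a 3 ∉ A then isingCorr G Aᶜ (2 * β) 0 .free {a 2, a 3} else 0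
       let E : (Finset V → ℝ) → ℝ := fun f => (∑ A : Finset V, Zs A * f A) / ∑ A : Finset V, Zs A
       E (fun A => X A * Y A) ≤ (1 - c) * E X * E Y)) :
    (let Gc : Fin 4 → Fin 4 → ℝ := fun i j => isingCorr G Finset.univ β 0 .free {a i, a j}
     2 * c * (Gc 0 1 * Gc 2 3) ≤
       Gc 0 1 * Gc 2 3 + Gc 0 2 * Gc 1 3 + Gc 0 3 * Gc 1 2
         - isingCorr G Finset.univ β 0 .free (Finset.univ.image a)) := by
  simp only at hrep hgain ⊢
  obtain ⟨hcov, hblue, hred⟩ := hrep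
  exact int_arith hcov hblue hred hgain

/-- **Clean transfer `INT → C′` at one scale**: (★) + three-clean + symmetry turn INT with
constant `c₀` into `LHS_clean ≤ (1 − (2/3)c₀)·Z₀₁·G₂₃` (`StrandShadowClean` at this `(N,a)`). -/
theorem clean_core {β c₀ : ℝ} (hβ : 0 ≤ β) (a : Fin 4 → V)
    (hps : (∑ F ∈ (tJoins G Set.univ {a 0, a 1}).filter (fun F : Finset (Sym2 V) =>
            ¬ (SimpleGraph.fromEdgeSet (↑F : Set (Sym2 V))).Reachable (a 0) (a 2) ∧
            ¬ (SimpleGraph.fromEdgeSet (↑F : Set (Sym2 V))).Reachable (a 0) (a 3)),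
          Real.tanh β ^ F.card * isingCorr G (Finset.univ.filter fun v : V =>
            ¬ (SimpleGraph.fromEdgeSet (↑F : Set (Sym2 V))).Reachable (a 0) v) β 0 .free {a 2, a 3})
        = ∑ F ∈ (tJoins G Set.univ (Finset.univ.image a)).filter (fun F : Finset (Sym2 V) =>
            ¬ (SimpleGraph.fromEdgeSet (↑F : Set (Sym2 V))).Reachable (a 0) (a 2) ∧
            ¬ (SimpleGraph.fromEdgeSet (↑F : Set (Sym2 V))).Reachable (a 0) (a 3)),
          Real.tanh β ^ F.card)
    (htc : (∑ F ∈ (tJoins G Set.univ (Finset.univ.image a)).filter (fun F : Finset (Sym2 V) =>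
            ¬ (SimpleGraph.fromEdgeSet (↑F : Set (Sym2 V))).Reachable (a 0) (a 2) ∧
            ¬ (SimpleGraph.fromEdgeSet (↑F : Set (Sym2 V))).Reachable (a 0) (a 3)),
            Real.tanh β ^ F.card) +
      (∑ F ∈ (tJoins G Set.univ (Finset.univ.image a)).filter (fun F : Finset (Sym2 V) =>
            ¬ (SimpleGraph.fromEdgeSet (↑F : Set (Sym2 V))).Reachable (a 0) (a 1) ∧
            ¬ (SimpleGraph.fromEdgeSet (↑F : Set (Sym2 V))).Reachable (a 0) (a 3)),
            Real.tanh β ^ F.card) +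
      (∑ F ∈ (tJoins G Set.univ (Finset.univ.image a)).filter (fun F : Finset (Sym2 V) =>
            ¬ (SimpleGraph.fromEdgeSet (↑F : Set (Sym2 V))).Reachable (a 0) (a 1) ∧
            ¬ (SimpleGraph.fromEdgeSet (↑F : Set (Sym2 V))).Reachable (a 0) (a 2)),
            Real.tanh β ^ F.card)
        ≤ ∑ F ∈ tJoins G Set.univ (Finset.univ.image a), Real.tanh β ^ F.card)
    (hsym : (let Gc : Fin 4 → Fin 4 → ℝ := fun i j => isingCorr G Finset.univ β 0 .free {a i, a j}
       let C : Fin 4 → Fin 4 → ℝ := fun j k =>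
         ∑ F ∈ (tJoins G Set.univ (Finset.univ.image a)).filter (fun F : Finset (Sym2 V) =>
            ¬ (SimpleGraph.fromEdgeSet (↑F : Set (Sym2 V))).Reachable (a 0) (a j) ∧
            ¬ (SimpleGraph.fromEdgeSet (↑F : Set (Sym2 V))).Reachable (a 0) (a k)),
           Real.tanh β ^ F.card
       Gc 0 2 = Gc 0 1 ∧ Gc 0 3 = Gc 0 1 ∧ Gc 1 3 = Gc 2 3 ∧ Gc 1 2 = Gc 2 3 ∧
         C 1 3 = C 2 3 ∧ C 1 2 = C 2 3))
    (hINT : (let Gc : Fin 4 → Fin 4 → ℝ := fun i j => isingCorr G Finset.univ β 0 .free {a i, a j}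
     2 * c₀ * (Gc 0 1 * Gc 2 3) ≤
       Gc 0 1 * Gc 2 3 + Gc 0 2 * Gc 1 3 + Gc 0 3 * Gc 1 2
         - isingCorr G Finset.univ β 0 .free (Finset.univ.image a))) :
    (∑ F ∈ (tJoins G Set.univ {a 0, a 1}).filter (fun F : Finset (Sym2 V) =>
            ¬ (SimpleGraph.fromEdgeSet (↑F : Set (Sym2 V))).Reachable (a 0) (a 2) ∧
            ¬ (SimpleGraph.fromEdgeSet (↑F : Set (Sym2 V))).Reachable (a 0) (a 3)),
          Real.tanh β ^ F.card * isingCorr G (Finset.univ.filter fun v : V =>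
            ¬ (SimpleGraph.fromEdgeSet (↑F : Set (Sym2 V))).Reachable (a 0) v) β 0 .free {a 2, a 3})
      ≤ (1 - 2 / 3 * c₀) * loopO1PartitionFunction G (Real.tanh β) {a 0, a 1} *
          isingCorr G Finset.univ β 0 .free {a 2, a 3} := by
  simp only at hsym hINT
  obtain ⟨hs02, hs03, hs13, hs12, hsC13, hsC12⟩ := hsym
  have ht : 0 ≤ Real.tanh β := by
    rw [Real.tanh_eq_sinh_div_cosh]
    exact div_nonneg (Real.sinh_nonneg_iff.2 hβ) (Real.cosh_pos _).le
  have hZ0pos : 0 < loopO1PartitionFunction G (Real.tanh β) ∅ :=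
    loopO1PartitionFunction_empty_pos G ht
  have hdict01 := isingCorr_univ_mul_loopO1_empty G β {a 0, a 1}
  have hdictA : isingCorr G Finset.univ β 0 .free (Finset.univ.image a) *
      loopO1PartitionFunction G (Real.tanh β) ∅ =
        ∑ F ∈ tJoins G Set.univ (Finset.univ.image a), Real.tanh β ^ F.card := by
    rw [isingCorr_univ_mul_loopO1_empty G β, DepletionBound.loopO1PartitionFunction_eq_hteSum,
      DepletionBound.sum_tJoins_pow_eq_hteSum]
  rw [hs02, hs03, hs13, hs12] at hINT
  rw [hps]
  set σA := isingCorr G Finset.univ β 0 .free (Finset.univ.image a)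
  set G01 := isingCorr G Finset.univ β 0 .free {a 0, a 1}
  set G23 := isingCorr G Finset.univ β 0 .free {a 2, a 3}
  set Z0 := loopO1PartitionFunction G (Real.tanh β) ∅
  have hINT' : σA ≤ (3 - 2 * c₀) * (G01 * G23) := by linarith
  have h3 : 3 * (∑ F ∈ (tJoins G Set.univ (Finset.univ.image a)).filter (fun F : Finset (Sym2 V) =>
      ¬ (SimpleGraph.fromEdgeSet (↑F : Set (Sym2 V))).Reachable (a 0) (a 2) ∧
      ¬ (SimpleGraph.fromEdgeSet (↑F : Set (Sym2 V))).Reachable (a 0) (a 3)), Real.tanh β ^ F.card)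
        ≤ σA * Z0 := by
    rw [hdictA]; linarith [htc, hsC13, hsC12]
  have h4 : σA * Z0 ≤ (3 - 2 * c₀) * (loopO1PartitionFunction G (Real.tanh β) {a 0, a 1} * G23) :=
    calc σA * Z0 ≤ (3 - 2 * c₀) * (G01 * G23) * Z0 := mul_le_mul_of_nonneg_right hINT' hZ0pos.le
      _ = (3 - 2 * c₀) * (loopO1PartitionFunction G (Real.tanh β) {a 0, a 1} * G23) := by
        rw [← hdict01]; ring
  linarith [h3, h4]

end Decomp

end Summit.CriticalPhenomena.Ising3DConformalLimit.Theorems.StrandShadowSketch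

end
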